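import Literature.Computability.Complexity.PermanentModTwoPowFP
import HarnessLib

/-!
# The permanent modulo `2^k` in polynomial time, V: the stages, and `pm K` on codes

L. G. Valiant, *The complexity of computing the permanent*, TCS 8 (1979), Thm. 3. Second half of the
machine side of `PermMod2.pm` (`PermanentModTwoPowAlgorithm.lean`), continuing
`PermanentModTwoPowFP.lean` (`elimFP`):

* §4 `stage_eq_ite` (the stage in branch form: empty / odd pivot found by `findIdx` / all-even
  column) and **`stageFP`** (pivot search `findIdxFP`, the odd inverse by `natPow` with a constant
  unary exponent, `elimFP`, `evenCorrFP`);
* §5 `stage_small` (the size invariant of a stage on ANY input: rows never multiply or lengthen,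
  entries and scalars stay residues), **`stagesFP`** (a fold of stages with that quadratic accumulator
  bound) and **`pmFP : ∀ K, CodeFP (rawE (rawE natE)) natE (pm K)`** by induction on `K` — for each
  fixed `k` the permanent modulo `2^k` of a matrix of naturals, given by the raw code of its rows, is
  computed by a polynomial-time string function (the exponent grows with `k`, as in Valiant's
  `O(n^{4k-3})`).

## References

* [Valiant1979] L. G. Valiant, *The complexity of computing the permanent*, Theoret. Comput. Sci.
  8 (1979) 189–201, Thm. 3.
* [AroraBarak2009] S. Arora, B. Barak, *Computational Complexity: A Modern Approach*, CUP 2009, §1.3.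
-/

namespace Literature.Computability.Complexity

namespace PermMod2FP

open CodeFP Polynomial _root_.Computability Brick ModArith Literature.LinearAlgebra.Matrix.PermMod2

variable {α σ : Type} {eα : α → List Bool} {eσ : σ → List Bool}

/-! ### §4 One stage on codes -/

/-- `firstOdd` is `findIdx?` of the decidable oddness test. [folklore] -/
theorem firstOdd_eq (l : List ℕ) : firstOdd l = l.findIdx? fun x => decide (x % 2 = 1) := by
  unfold firstOdd
  congr 1

/-- **`stage` in branch form**: empty matrix / an odd pivot found by `findIdx` / an all-even column. [folklore] -/
theorem stage_eq_ite (K : ℕ) (prev : List (List ℕ) → ℕ) (B : List (List ℕ)) (μ acc : ℕ) :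
    stage K prev (B, μ, acc) =
      if B.isEmpty then (B, μ, acc)
      else if (B.map fun r => r.headD 0).findIdx (fun x => decide (x % 2 = 1)) < (B.map fun r => r.headD 0).length then
        (((elim K prev (B.getD ((B.map fun r => r.headD 0).findIdx fun x => decide (x % 2 = 1)) [])
            (oddInv K ((B.getD ((B.map fun r => r.headD 0).findIdx fun x => decide (x % 2 = 1)) []).headD 0)) []
            (B.eraseIdx ((B.map fun r => r.headD 0).findIdx fun x => decide (x % 2 = 1))) 0).1.map List.tail),
          μ * (B.getD ((B.map fun r => r.headD 0).findIdx fun x => decide (x % 2 = 1)) []).headD 0 % 2 ^ K,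
          (acc + μ * (elim K prev (B.getD ((B.map fun r => r.headD 0).findIdx fun x => decide (x % 2 = 1)) [])
            (oddInv K ((B.getD ((B.map fun r => r.headD 0).findIdx fun x => decide (x % 2 = 1)) []).headD 0)) []
            (B.eraseIdx ((B.map fun r => r.headD 0).findIdx fun x => decide (x % 2 = 1))) 0).2) % 2 ^ K)
      else ([], 0, (acc + μ * evenCorr K prev B) % 2 ^ K) := by
  cases B with
  | nil => rfl
  | cons r B' =>
    rw [stage_cons, List.isEmpty_cons, firstOdd_eq, List.findIdx?_eq_guard_findIdx_lt, Option.guard]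
    by_cases h : (List.map (fun r => r.headD 0) (r :: B')).findIdx (fun x => decide (x % 2 = 1)) <
        (List.map (fun r => r.headD 0) (r :: B')).length
    · simp only [h, decide_true, ↓reduceIte, Bool.false_eq_true]
    · simp only [h, decide_false, ↓reduceIte, Bool.false_eq_true]

/-- **`stage K prev` on codes**, given `prev` on codes. [cite: Valiant1979, Thm. 3 (proof)] [cite: AroraBarak2009, §1.3] -/
theorem stageFP (K : ℕ) {prev : List (List ℕ) → ℕ} (hprev : CodeFP (rawE (rawE natE)) natE prev) :
    CodeFP (pairE (rawE (rawE natE)) (pairE natE natE)) (pairE (rawE (rawE natE)) (pairE natE natE)) (stage K prev) := by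
  have hB : CodeFP (pairE (rawE (rawE natE)) (pairE natE natE)) (rawE (rawE natE)) Prod.fst := fst _ _
  have hμ : CodeFP (pairE (rawE (rawE natE)) (pairE natE natE)) natE (fun st => st.2.1) := (snd _ _).fst'
  have hacc : CodeFP (pairE (rawE (rawE natE)) (pairE natE natE)) natE (fun st => st.2.2) := (snd _ _).snd'
  have hNc : CodeFP (pairE (rawE (rawE natE)) (pairE natE natE)) natE (fun _ => 2 ^ K) := const _ _
  have hheads : CodeFP (pairE (rawE (rawE natE)) (pairE natE natE)) (rawE natE) (fun st => st.1.map fun r => r.headD 0) := headsFP.comp hB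
  -- the pivot search
  have hpred : CodeFP (pairE unitE natE) bitE (fun t => decide (t.2 % 2 = 1)) :=
    natEq.comp ((natMod.comp ((snd _ _).pair (const _ 2))).pair (const _ 1))
  have hp : CodeFP (pairE (rawE (rawE natE)) (pairE natE natE)) natE (fun st => (st.1.map fun r => r.headD 0).findIdx fun x => decide (x % 2 = 1)) :=
    ((findIdxFP (σ := Unit) (eσ := unitE) (eα := natE) hpred).comp ((const _ ()).pair hheads)).congr fun _ => rfl
  have hfound : CodeFP (pairE (rawE (rawE natE)) (pairE natE natE)) bitE (fun st => decide ((st.1.map fun r => r.headD 0).findIdx (fun x => decide (x % 2 = 1)) <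
      (st.1.map fun r => r.headD 0).length)) := natLt.comp (hp.pair ((natLength natE).comp hheads))
  -- the pivot branch
  have hq : CodeFP (pairE (rawE (rawE natE)) (pairE natE natE)) (rawE natE) (fun st => st.1.getD ((st.1.map fun r => r.headD 0).findIdx fun x => decide (x % 2 = 1)) []) :=
    (rawGetD (rawE natE) (d := []) rfl).comp (hB.pair hp)
  have hc : CodeFP (pairE (rawE (rawE natE)) (pairE natE natE)) natE (fun st => (st.1.getD ((st.1.map fun r => r.headD 0).findIdx fun x => decide (x % 2 = 1)) []).headD 0) :=
    headD0FP.comp hq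
  have hu : CodeFP (pairE (rawE (rawE natE)) (pairE natE natE)) natE (fun st => oddInv K ((st.1.getD ((st.1.map fun r => r.headD 0).findIdx fun x =>
      decide (x % 2 = 1)) []).headD 0)) :=
    (natMod.comp ((natPow.comp (hc.pair (const _ (2 ^ (K - 1) - 1)))).pair hNc)).congr fun _ => rfl
  have hrest : CodeFP (pairE (rawE (rawE natE)) (pairE natE natE)) (rawE (rawE natE)) (fun st => st.1.eraseIdx ((st.1.map fun r => r.headD 0).findIdx fun x => decide (x % 2 = 1))) :=
    eraseIdxOf hp hB
  have hE := (elimFP K hprev).comp ((hq.pair hu).pair ((const _ ([] : List (List ℕ))).pair (hrest.pair (const _ (0 : ℕ)))))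
  have hpiv : CodeFP (pairE (rawE (rawE natE)) (pairE natE natE)) (pairE (rawE (rawE natE)) (pairE natE natE)) (fun st =>
      (((elim K prev (st.1.getD ((st.1.map fun r => r.headD 0).findIdx fun x => decide (x % 2 = 1)) [])
          (oddInv K ((st.1.getD ((st.1.map fun r => r.headD 0).findIdx fun x => decide (x % 2 = 1)) []).headD 0)) []
          (st.1.eraseIdx ((st.1.map fun r => r.headD 0).findIdx fun x => decide (x % 2 = 1))) 0).1.map List.tail),
        st.2.1 * (st.1.getD ((st.1.map fun r => r.headD 0).findIdx fun x => decide (x % 2 = 1)) []).headD 0 % 2 ^ K,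
        (st.2.2 + st.2.1 * (elim K prev (st.1.getD ((st.1.map fun r => r.headD 0).findIdx fun x => decide (x % 2 = 1)) [])
          (oddInv K ((st.1.getD ((st.1.map fun r => r.headD 0).findIdx fun x => decide (x % 2 = 1)) []).headD 0)) []
          (st.1.eraseIdx ((st.1.map fun r => r.headD 0).findIdx fun x => decide (x % 2 = 1))) 0).2) % 2 ^ K)) :=
    ((map₀ (rawTail natE)).comp hE.fst').pair ((natMod.comp ((natMul.comp (hμ.pair hc)).pair hNc)).pair
      (natMod.comp ((natAdd.comp (hacc.pair (natMul.comp (hμ.pair hE.snd')))).pair hNc)))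
  -- the all-even branch
  have heven : CodeFP (pairE (rawE (rawE natE)) (pairE natE natE)) (pairE (rawE (rawE natE)) (pairE natE natE)) (fun st => (([] : List (List ℕ)), (0 : ℕ), (st.2.2 + st.2.1 * evenCorr K prev st.1) % 2 ^ K)) :=
    (const _ ([] : List (List ℕ))).pair ((const _ (0 : ℕ)).pair
      (natMod.comp ((natAdd.comp (hacc.pair (natMul.comp (hμ.pair ((evenCorrFP K hprev).comp hB))))).pair hNc)))
  -- assemble
  refine ((((rawIsEmpty (rawE natE)).comp hB).ite (CodeFP.id _) (hfound.ite hpiv heven)).congr fun st => ?_)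
  obtain ⟨B, μ, acc⟩ := st
  rw [stage_eq_ite]
  simp only [id]
  by_cases h1 : B.isEmpty = true
  · simp [h1]
  · simp only [h1]
    by_cases h2 : (B.map fun r => r.headD 0).findIdx (fun x => decide (x % 2 = 1)) < (B.map fun r => r.headD 0).length
    · rw [if_pos h2, decide_eq_true h2, if_pos rfl]
    · rw [if_neg h2, decide_eq_false h2]; rfl

/-! ### §5 All stages, and `pm` on codes -/

/-- The elimination loop outputs one row per row it consumed. [folklore] -/
theorem length_elim_fst (K : ℕ) (prev : List (List ℕ) → ℕ) (q : List ℕ) (u : ℕ) :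
    ∀ (todo done : List (List ℕ)) (corr : ℕ),
      (elim K prev q u done todo corr).1.length = done.length + todo.length := by
  intro todo
  induction todo with
  | nil => intro done corr; simp
  | cons r rest ih => intro done corr; rw [elim_cons, ih]; simp; omega

/-- Every output row of the elimination loop is an old `done` row or an `addRow … q`. [folklore] -/
theorem mem_elim_fst (K : ℕ) (prev : List (List ℕ) → ℕ) (q : List ℕ) (u : ℕ) :
    ∀ (todo done : List (List ℕ)) (corr : ℕ), ∀ row ∈ (elim K prev q u done todo corr).1,
      row ∈ done ∨ ∃ d r, row = addRow (2 ^ K) d r q := by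
  intro todo
  induction todo with
  | nil => intro done corr row h; exact Or.inl (by simpa using h)
  | cons r rest ih =>
    intro done corr row h
    rw [elim_cons] at h
    rcases ih _ _ row h with h' | h'
    · rw [List.mem_append, List.mem_singleton] at h'
      rcases h' with h' | rfl
      · exact Or.inl h'
      · exact Or.inr ⟨_, _, rfl⟩
    · exact Or.inr h'

/-- **The size invariant of a stage** (on ANY input, well formed or not): the number of rows does not
grow, every row is no longer than a bound `M` dominating the rows and consists of residues modulo
`N = 2^K`, and `μ`, `acc` are at most `N`. [folklore] -/
theorem stage_small (K : ℕ) (prev : List (List ℕ) → ℕ) {M R : ℕ} (B : List (List ℕ)) (μ acc : ℕ)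
    (hR : B.length ≤ R) (hrows : ∀ row ∈ B, row.length ≤ M ∧ ∀ x ∈ row, x < 2 ^ K) (hμ : μ ≤ 2 ^ K) (hacc : acc ≤ 2 ^ K) :
    (stage K prev (B, μ, acc)).1.length ≤ R ∧
      (∀ row ∈ (stage K prev (B, μ, acc)).1, row.length ≤ M ∧ ∀ x ∈ row, x < 2 ^ K) ∧
      (stage K prev (B, μ, acc)).2.1 ≤ 2 ^ K ∧ (stage K prev (B, μ, acc)).2.2 ≤ 2 ^ K := by
  have hN : 0 < 2 ^ K := Nat.two_pow_pos K
  cases B with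
  | nil => exact ⟨hR, hrows, hμ, hacc⟩
  | cons r B' =>
    rw [stage_cons]
    cases hodd : firstOdd ((r :: B').map fun r => r.headD 0) with
    | none => exact ⟨Nat.zero_le _, fun _ h => by simp at h, Nat.zero_le _, (Nat.mod_lt _ hN).le⟩
    | some p =>
      obtain ⟨hp, -, -⟩ := List.findIdx?_eq_some_iff_getElem.1 hodd
      rw [List.length_map] at hp
      set q := (r :: B').getD p [] with hq
      have hqmem : q ∈ r :: B' := by
        rw [hq, List.getD_eq_getElem?_getD, List.getElem?_eq_getElem hp]; exact List.getElem_mem hp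
      have hqM : q.length ≤ M := (hrows q hqmem).1
      set E := elim K prev q (oddInv K (q.headD 0)) [] ((r :: B').eraseIdx p) 0 with hE
      refine ⟨?_, fun row hrow => ?_, (Nat.mod_lt _ hN).le, (Nat.mod_lt _ hN).le⟩
      · show (E.1.map List.tail).length ≤ R
        rw [List.length_map, hE, length_elim_fst, List.length_nil, zero_add, List.length_eraseIdx]
        simp only [hp, ↓reduceIte]
        simp only [List.length_cons] at hR ⊢; omega
      · change row ∈ E.1.map List.tail at hrow
        rw [List.mem_map] at hrow
        obtain ⟨row₀, hmem, rfl⟩ := hrow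
        rcases mem_elim_fst K prev q _ _ _ _ row₀ hmem with h | ⟨d, r₀, rfl⟩
        · simp at h
        · exact ⟨(by rw [List.length_tail]; exact (Nat.sub_le _ _).trans ((length_addRow_le _ _ _ _).trans hqM)),
            fun x hx => addRow_lt hN r₀ q x (List.mem_of_mem_tail hx)⟩

/-- **`stages K prev` on codes**, given `prev` on codes: a fold of `stage` over a budget of `|L|`
rounds from `(L mod N, 1, 0)`; the accumulator is polynomially bounded by `stage_small` (rows never
multiply or lengthen, entries and scalars are residues). [cite: Valiant1979, Thm. 3 (proof)] [cite: AroraBarak2009, §1.3] -/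
theorem stagesFP (K : ℕ) {prev : List (List ℕ) → ℕ} (hprev : CodeFP (rawE (rawE natE)) natE prev) :
    CodeFP (rawE (rawE natE)) (pairE (rawE (rawE natE)) (pairE natE natE)) (stages K prev) := by
  set N := 2 ^ K with hN
  have hNpos : 0 < N := Nat.two_pow_pos K
  set cN := (natE N).length with hcN
  -- step and initial state
  have hstep : CodeFP (pairE (rawE (rawE natE)) (pairE natE (pairE (rawE (rawE natE)) (pairE natE natE)))) (pairE (rawE (rawE natE)) (pairE natE natE)) (fun t => stage K prev t.2.2) := (stageFP K hprev).comp (snd _ _).snd'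
  have hmodrow : CodeFP (rawE natE) (rawE natE) (fun r => r.map fun x => x % N) := map₀ (natMod.comp ((CodeFP.id _).pair (const _ N)))
  have hinit : CodeFP (rawE (rawE natE)) (pairE (rawE (rawE natE)) (pairE natE natE)) (fun L => (L.map fun r => r.map fun x => x % N, (1 : ℕ), (0 : ℕ))) :=
    (map₀ hmodrow).pair ((const _ (1 : ℕ)).pair (const _ (0 : ℕ)))
  -- the invariant along any run
  have hinv : ∀ (L : List (List ℕ)) (l : List ℕ),
      let st := l.foldl (fun st _ => stage K prev st) (L.map fun r => r.map fun x => x % N, 1, 0)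
      st.1.length ≤ L.length ∧ (∀ row ∈ st.1, row.length ≤ (rawE (rawE natE) L).length ∧ ∀ x ∈ row, x < 2 ^ K) ∧
        st.2.1 ≤ 2 ^ K ∧ st.2.2 ≤ 2 ^ K := by
    intro L l
    induction l using List.reverseRecOn with
    | nil =>
      refine ⟨by simp, fun row hrow => ?_, Nat.one_le_two_pow, Nat.zero_le _⟩
      simp only [List.foldl_nil, List.mem_map] at hrow
      obtain ⟨row₀, hmem, rfl⟩ := hrow
      refine ⟨?_, fun x hx => ?_⟩
      · rw [List.length_map]
        exact (length_le_length_rawE natE row₀).trans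
          (by have := length_item_le_length_rawE (rawE natE) hmem; omega)
      · rw [List.mem_map] at hx
        obtain ⟨y, -, rfl⟩ := hx
        exact Nat.mod_lt _ hNpos
    | append_singleton l a ih =>
      obtain ⟨h1, h2, h3, h4⟩ := ih
      simp only [List.foldl_append, List.foldl_cons, List.foldl_nil]
      set st := l.foldl (fun st _ => stage K prev st) (L.map fun r => r.map fun x => x % N, 1, 0)
      obtain ⟨B, μ, acc⟩ := st
      exact stage_small K prev B μ acc h1 h2 h3 h4
  have h := foldl (σ := List (List ℕ)) (α := ℕ) (β := List (List ℕ) × ℕ × ℕ) (eσ := (rawE (rawE natE))) (eα := natE) (eβ := (pairE (rawE (rawE natE)) (pairE natE natE)))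
    (step := fun _ _ st => stage K prev st) (init := fun L => (L.map fun r => r.map fun x => x % N, 1, 0)) hstep hinit
    (X * X * Polynomial.C (8 * cN + 8) + 4 * X + Polynomial.C (3 * cN + 4)) (fun L l₁ l₂ => by
      obtain ⟨h1, h2, h3, h4⟩ := hinv L l₁
      set st := l₁.foldl (fun st _ => stage K prev st) (L.map fun r => r.map fun x => x % N, 1, 0)
      obtain ⟨B, μ, acc⟩ := st
      simp only at h1 h2 h3 h4
      set w := pairE (rawE (rawE natE)) (rawE natE) (L, l₁ ++ l₂) with hw
      have hwL : (rawE (rawE natE) L).length ≤ w.length := by simp only [hw, pairE_apply, length_boolPair]; omega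
      have hLlen : L.length ≤ w.length := (length_le_length_rawE (rawE natE) L).trans hwL
      have hB : (rawE (rawE natE) B).length ≤ w.length * (w.length * (4 * cN + 4) + 2) := by
        rw [length_rawE]
        have hitem : ∀ x ∈ B.map (fun a => 2 * (rawE natE a).length + 2), x ≤ w.length * (4 * cN + 4) + 2 := by
          intro x hx
          rw [List.mem_map] at hx
          obtain ⟨row, hrow, rfl⟩ := hx
          have h5 := length_vecE_le (h2 row hrow).1 (h2 row hrow).2
          rw [← hN, ← hcN] at h5
          have h6 : (rawE (rawE natE) L).length * (2 * cN + 2) ≤ w.length * (2 * cN + 2) := Nat.mul_le_mul_right _ hwL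
          have h7 : w.length * (4 * cN + 4) = 2 * (w.length * (2 * cN + 2)) := by ring
          omega
        have hs := List.sum_le_card_nsmul _ _ hitem
        rw [List.length_map, smul_eq_mul] at hs
        exact hs.trans (Nat.mul_le_mul_right _ (h1.trans hLlen))
      have hμ : (natE μ).length ≤ cN := by rw [hcN]; exact IntDetFP.length_natE_mono h3
      have hacc : (natE acc).length ≤ cN := by rw [hcN]; exact IntDetFP.length_natE_mono h4
      simp only [pairE_apply, length_boolPair, eval_add, eval_mul, eval_X, eval_C, eval_ofNat]
      nlinarith [hB, hμ, hacc])
  have hitems : CodeFP (rawE (rawE natE)) (rawE natE) (fun L => List.range L.length) := urange.comp (ulength (rawE natE))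
  exact (h.comp ((CodeFP.id _).pair hitems)).congr fun L => rfl

/-- **Valiant's algorithm runs in polynomial time: `pm K` on codes**, for every fixed `K` (by
induction on `K`, each level a fold of stages calling the previous level on the minors).
[cite: Valiant1979, Thm. 3] [cite: AroraBarak2009, §1.3] -/
theorem pmFP : ∀ K : ℕ, CodeFP (rawE (rawE natE)) natE (pm K)
  | 0 => (const _ 0).congr fun L => (pm_zero L).symm
  | K + 1 => by
    have hs := stagesFP (K + 1) (pmFP K)
    exact ((natMod.comp ((natAdd.comp (hs.snd'.fst'.pair hs.snd'.snd')).pair (const _ (2 ^ (K + 1))))).congr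
      fun L => (pm_succ K L).symm)

end PermMod2FP

end Literature.Computability.Complexity
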